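/-
Copyright: the b2b-balaban T⁴-continuum CRUX team, row NE7b leaf lineage `t4-ne7b-formalise-leaf-06` (gen 155). Project licence.
-/
import Summits.QuantumFields.BalabanUV.T4Continuum.Spine.NE7b.HardStepInductiveStep
import Summits.QuantumFields.BalabanUV.T4Continuum.Spine.NE7b.HardStepRescalingLetters
import Summits.QuantumFields.BalabanUV.T4Continuum.Spine.NE7b.TransportedFormCoercivity

/-!
# THE HARD-STEP TOWER RE-ENTERS: inductive step ∘ rescaling ∘ inductive step composes IN SHAPE — from the scale-`k` letters, a
# homothety `t ≠ 0` and the scale-`(k+1)` blocking data, TWO charts `σ₁`, `σ₂` with the twice-renormalised action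
# `((V ∘ σ₁) ∘ (t•)) ∘ σ₂` FULLY critical at its centre (§2), and — abstractly — `inductiveStep`'s COMPLETE letter block at scale
# `k+1` from HSRL's letters at scale `k` (§1), with explicit constants (row NE7b, node U5c; assembly of this lineage's
# `HardStepInductiveStep` (HSIS) and `HardStepRescalingLetters` (HSRL) BY NAME; [folklore])

Cell `pub-balaban`, sub-cell `t4`, spine estimate NE7b (`T4WeightBudget.RelWeightBound`; the cell's OWN estimate — NOT PRINTED in
[Bałaban 1983–89], NOT PROVED).  Crux-route work under `Spine/NE7b/` by a row leaf (`t4-ne7b-formalise-leaf-06` gen 155) in the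
hard-step cell under FREEZE (0)'s crux-prover clause; NOTHING of Bałaban's is named as a Lean object, valued or asserted; no
`T4Continuum/Support` leaf typed; no `def`; zero `sorry`.  Imports: HSIS (`inductiveStep`) and HSRL (`rescaled_letters`) — both
this lineage's; through HSIS the six hard-step parents (AHE, HSCR, HSBD, HSBDM, HSAH, HSTL) — and leaf-03 g148's
`TransportedFormCoercivity` (TFC, `kerCoercive_bilinearComp_div`, for §3's discharge of the coercivity hypothesis).

WHY.  HSIS is ONE step of the tower (scale `k` letters on `closedBall δ₀ r` ⟹ chart `σ` + next action `V ∘ σ` with letters on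
`ball (Dδ₀) ρ`, `ρ = (N⁻¹ − c)r`); HSRL transports every output letter through the homothety `v ↦ t • v` (radius `ρ∕|t|`, explicit
powers of `|t|`).  Whether the INDUCTION CLOSES IN SHAPE — whether HSRL's output, restricted to a closed ball `closedBall (t⁻¹ • Dδ₀) r₂`
with `r₂ < ρ∕|t|`, is again an input of `inductiveStep` at scale `k+1` — is the content of this file: it is, with the next modulus
`c₂ ≥ |t|³Λ₃·r₂` (HSIS `nextModulus_on_closedBall`'s shape), the next Hessian size `t²H`, the next gradient size `|t|G₁`, the next
Hessian-Lipschitz constant `|t|³Λ₃`, and the next equivalence bound `N₂` from `(1 + t²H∕m₂)‖M₂‖ + m₂⁻¹ ≤ N₂` (AHE's condition, monotone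
in the Hessian size).  What does NOT close in shape is honest and displayed: the next kernel coercivity `m₂` of the rescaled transported
Hessian `t² • U″(w₀)` on `ker D₂` is a HYPOTHESIS (`hco₂`; TFC's two-scale letter supplies it for `U″(w₀) = V″(δ₀)[σ′·, σ′·]`), and the
NUMERICAL non-degradation of `(N_k, c_k, r_k, B_k, Λ_k)` along the tower is (A3) — idea-1's «closing family `c_k < N_k⁻¹`».

WHAT IS PROVED ([folklore] assembly; `E`, `F` real Hilbert spaces (HSIS's fine-space requirement at the two scales), `F₂` a real normed space):
* §1 **`nextStep_of_letters`** — ABSTRACT RE-ENTRY: a chart `σ₁ : F → E` and an action `U : F → ℝ` with HSRL's input letters on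
  `ball w₀ ρ` (constants `K₁, Λ₁, G₁, Λ₂, H, Λ₃`, Hessian `U″`, `DU(w₀) = 0`), `t ≠ 0`, and scale-`(k+1)` data — blocking `D₂ : F →L F₂`
  with right inverse `M₂`, kernel coercivity `m₂` of `t² • U″(w₀)` on `ker D₂`, `N₂, c₂ : ℝ≥0` with `c₂ < N₂⁻¹`,
  `(1 + t²H∕m₂)‖M₂‖ + m₂⁻¹ ≤ N₂`, a radius `0 < r₂ < ρ∕|t|` with `|t|³Λ₃·r₂ ≤ c₂`, `0 ≤ Λ₃` ⟹ `inductiveStep`'s CONCLUSION at scale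
  `k+1` for `V := U ∘ (t•)`, `V″ := t² • U″(t • ·)`, centre `t⁻¹ • w₀`, radius `r₂`, sizes `(|t|³Λ₃, t²H, |t|G₁)`: a chart `σ₂ : F₂ → F`
  with the full letter block (a)–(d).
* §2 **`twoSteps`** — THE COMPOSITION: `inductiveStep`'s scale-`k` hypotheses VERBATIM, `t ≠ 0`, and the scale-`(k+1)` data as in §1
  with `K₁ := (N⁻¹ − c)⁻¹`, `ρ := (N⁻¹ − c)r`, `G₁ := GK₁`, `H := BK₁²`, `Λ₃ := M₃K₁K₁²(1 + 2BK₁)` and the coercivity hypothesis in the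
  UNIVERSAL form `∀ S, (D(Sk) = k ∀k) → ‖S‖ ≤ K₁ → t² • V″(δ₀)[S·, S·]` is `m₂`-coercive on `ker D₂` (what TFC discharges) ⟹
  `∃ σ₁ σ₂`, `σ₁(Dδ₀) = δ₀`, `σ₂(D₂v₀) = v₀` (`v₀ := t⁻¹ • Dδ₀`), `σ₂`'s chart letters (a), the first-order letters (b) and FULL
  criticality (d) of `((V ∘ σ₁) ∘ (t•)) ∘ σ₂` at `D₂v₀` — the induction re-enters (the complete block (a)–(d) is §1's, `U := V ∘ σ₁`).
* §3 **`twoSteps_of_twoScale`** — THE SAME WITH TFC's LETTERS: the universal coercivity hypothesis of §2 discharged BY NAME from the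
  TWO-SCALE letter `∀ v, D₂(Dv) = 0 → m₂‖v‖² ≤ V″(δ₀) v v` and the blocking's size `‖Dv‖ ≤ d‖v‖` (`d > 0`, `m₂ > 0`)
  (`TransportedFormCoercivity.kerCoercive_bilinearComp_div`: `V″(δ₀)[S·,S·]` is `m₂∕d²`-coercive on `ker D₂` for EVERY section `S`),
  the next coercivity constant being `t²·m₂∕d²` and AHE's condition read with it.

NOT HERE (honest): `m₂`, `d` BY VALUE (which two-scale letter print's small-field action satisfies — (A3));
the choice of `t, r₂, N₂, c₂` making the family non-degrading in `k` ((A3) ∕ (A1c), NC-NE7b-α UNRULED — the step's displayed price); the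
`n`-step tower over a sequence of spaces (an induction over a `ℕ`-indexed family of Hilbert spaces — not attempted; two steps exhibit
the re-entry); the identification with the constrained VALUE (CMR ∕ CVH); anything of Bałaban's.  BY-NAME EFFECT ON THE WALL: NONE.
NE7b NOT PRINTED ∕ NOT PROVED; spine PROVED 0∕9; rung (B)+1 on a FINITE torus — NOT infinite volume, NOT the mass gap, NOT Clay.  HONEST
DEPENDENCY: continuum YM on T⁴ ⇐ BetaPertH ∧ nine spine estimates (0∕9 proved); BetaPertH ⇐ (D1) ∧ (D4) ∧ CAP+tail; G-an2-4 gates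
asym, D1 and NE2∕3∕4.
-/

set_option autoImplicit false

noncomputable section

namespace Summit.QuantumFields.BalabanUV.T4Continuum.NE7b.HardStepTowerTwoSteps

open Set Filter Topology Function Metric
open scoped NNReal
open Summit.QuantumFields.BalabanUV.T4Continuum.NE7b

variable {E F F₂ : Type*} [NormedAddCommGroup E] [InnerProductSpace ℝ E] [CompleteSpace E] [Nontrivial E]
  [NormedAddCommGroup F] [InnerProductSpace ℝ F] [CompleteSpace F] [Nontrivial F]
  [NormedAddCommGroup F₂] [NormedSpace ℝ F₂]

/-! ## §1. Abstract re-entry: HSRL's output, restricted to a closed ball, is `inductiveStep`'s input at the next scale -/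

omit [CompleteSpace E] [Nontrivial E] in
/-- **THE RE-ENTRY.**  HSRL's input letters for `(σ₁, U, U″)` on `ball w₀ ρ`, a homothety `t ≠ 0`, and the scale-`(k+1)` data
(`D₂`, `M₂`, `m₂`-coercivity of `t² • U″(w₀)` on `ker D₂`, `N₂`, `c₂ < N₂⁻¹`, `(1 + t²H∕m₂)‖M₂‖ + m₂⁻¹ ≤ N₂`, `0 < r₂ < ρ∕|t|`,
`|t|³Λ₃·r₂ ≤ c₂`, `0 ≤ Λ₃`) ⟹ `inductiveStep`'s conclusion at scale `k+1` for the rescaled action `U ∘ (t•)` with Hessian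
`t² • U″(t • ·)`, centre `t⁻¹ • w₀`, radius `r₂` and sizes `(M₃, B, G) := (|t|³Λ₃, t²H, |t|G₁)`. [folklore] -/
theorem nextStep_of_letters {σ₁ : F → E} {U : F → ℝ} {U'' : F → F →L[ℝ] F →L[ℝ] ℝ} (D : E →L[ℝ] F) {S : Set E} {w₀ : F}
    {ρ K₁ Λ₁ G₁ Λ₂ H Λ₃ t : ℝ} (ht : t ≠ 0) (hρ : 0 < ρ)
    (hσ : ∀ w ∈ ball w₀ ρ, σ₁ w ∈ S ∧ DifferentiableAt ℝ σ₁ w ∧ (∀ k, D (fderiv ℝ σ₁ w k) = k) ∧ ‖fderiv ℝ σ₁ w‖ ≤ K₁)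
    (hσ₂ : ∀ w ∈ ball w₀ ρ, ∀ w' ∈ ball w₀ ρ,
      ‖σ₁ w - σ₁ w'‖ ≤ K₁ * ‖w - w'‖ ∧ ‖fderiv ℝ σ₁ w - fderiv ℝ σ₁ w'‖ ≤ Λ₁ * ‖w - w'‖)
    (hU : ∀ w ∈ ball w₀ ρ, DifferentiableAt ℝ U w ∧ ‖fderiv ℝ U w‖ ≤ G₁)
    (hU₂ : ∀ w ∈ ball w₀ ρ, ∀ w' ∈ ball w₀ ρ, ‖fderiv ℝ U w - fderiv ℝ U w'‖ ≤ Λ₂ * ‖w - w'‖)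
    (hU'' : ∀ w ∈ ball w₀ ρ, HasFDerivAt (fderiv ℝ U) (U'' w) w ∧ ‖fderiv ℝ (fderiv ℝ U) w‖ ≤ H)
    (hU''₂ : ∀ w ∈ ball w₀ ρ, ∀ w' ∈ ball w₀ ρ,
      ‖fderiv ℝ (fderiv ℝ U) w - fderiv ℝ (fderiv ℝ U) w'‖ ≤ Λ₃ * ‖w - w'‖)
    (hcrit : fderiv ℝ U w₀ = 0) (hΛ₃ : 0 ≤ Λ₃)
    -- scale k+1
    (D₂ : F →L[ℝ] F₂) (M₂ : F₂ →L[ℝ] F) (hM₂ : ∀ u, D₂ (M₂ u) = u) {m₂ : ℝ} (hm₂ : 0 < m₂)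
    (hco₂ : ∀ κ, D₂ κ = 0 → m₂ * ‖κ‖ ^ 2 ≤ ((t ^ 2) • U'' w₀) κ κ)
    {N₂ c₂ : ℝ≥0} (hN₂ : (1 + t ^ 2 * H / m₂) * ‖M₂‖ + m₂⁻¹ ≤ (N₂ : ℝ)) (hc₂ : c₂ < N₂⁻¹)
    {r₂ : ℝ} (hr₂ : 0 < r₂) (hr₂ρ : r₂ < ρ / |t|) (hc₂r : |t| ^ 3 * Λ₃ * r₂ ≤ (c₂ : ℝ)) :
    ∃ σ₂ : F₂ → F, σ₂ (D₂ (t⁻¹ • w₀)) = t⁻¹ • w₀ ∧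
      (∀ u ∈ ball (D₂ (t⁻¹ • w₀)) (((N₂ : ℝ)⁻¹ - c₂) * r₂), σ₂ u ∈ closedBall (t⁻¹ • w₀) r₂ ∧ DifferentiableAt ℝ σ₂ u ∧
        (∀ k, D₂ (fderiv ℝ σ₂ u k) = k) ∧ ‖fderiv ℝ σ₂ u‖ ≤ ((N₂ : ℝ)⁻¹ - c₂)⁻¹) ∧
      (∀ u ∈ ball (D₂ (t⁻¹ • w₀)) (((N₂ : ℝ)⁻¹ - c₂) * r₂), ∀ u' ∈ ball (D₂ (t⁻¹ • w₀)) (((N₂ : ℝ)⁻¹ - c₂) * r₂),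
        ‖σ₂ u - σ₂ u'‖ ≤ ((N₂ : ℝ)⁻¹ - c₂)⁻¹ * ‖u - u'‖ ∧
        ‖fderiv ℝ σ₂ u - fderiv ℝ σ₂ u'‖ ≤
          (((N₂ : ℝ)⁻¹ - c₂)⁻¹) ^ 2 * (|t| ^ 3 * Λ₃) * ((N₂ : ℝ)⁻¹ - c₂)⁻¹ * ‖u - u'‖) ∧
      (∀ u ∈ ball (D₂ (t⁻¹ • w₀)) (((N₂ : ℝ)⁻¹ - c₂) * r₂), DifferentiableAt ℝ ((fun v : F => U (t • v)) ∘ σ₂) u ∧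
        ‖fderiv ℝ ((fun v : F => U (t • v)) ∘ σ₂) u‖ ≤ |t| * G₁ * ((N₂ : ℝ)⁻¹ - c₂)⁻¹) ∧
      (∀ u ∈ ball (D₂ (t⁻¹ • w₀)) (((N₂ : ℝ)⁻¹ - c₂) * r₂), ∀ u' ∈ ball (D₂ (t⁻¹ • w₀)) (((N₂ : ℝ)⁻¹ - c₂) * r₂),
        ‖fderiv ℝ ((fun v : F => U (t • v)) ∘ σ₂) u - fderiv ℝ ((fun v : F => U (t • v)) ∘ σ₂) u'‖ ≤
          (t ^ 2 * H * ((N₂ : ℝ)⁻¹ - c₂)⁻¹ * ((N₂ : ℝ)⁻¹ - c₂)⁻¹ +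
            |t| * G₁ * ((((N₂ : ℝ)⁻¹ - c₂)⁻¹) ^ 2 * (|t| ^ 3 * Λ₃) * ((N₂ : ℝ)⁻¹ - c₂)⁻¹)) * ‖u - u'‖) ∧
      (∀ u ∈ ball (D₂ (t⁻¹ • w₀)) (((N₂ : ℝ)⁻¹ - c₂) * r₂),
        HasFDerivAt (fderiv ℝ ((fun v : F => U (t • v)) ∘ σ₂))
          ((((t ^ 2) • U'' (t • σ₂ u))).bilinearComp (fderiv ℝ σ₂ u) (fderiv ℝ σ₂ u)) u ∧
        ‖fderiv ℝ (fderiv ℝ ((fun v : F => U (t • v)) ∘ σ₂)) u‖ ≤ t ^ 2 * H * (((N₂ : ℝ)⁻¹ - c₂)⁻¹) ^ 2) ∧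
      (∀ u ∈ ball (D₂ (t⁻¹ • w₀)) (((N₂ : ℝ)⁻¹ - c₂) * r₂), ∀ u' ∈ ball (D₂ (t⁻¹ • w₀)) (((N₂ : ℝ)⁻¹ - c₂) * r₂),
        ‖fderiv ℝ (fderiv ℝ ((fun v : F => U (t • v)) ∘ σ₂)) u - fderiv ℝ (fderiv ℝ ((fun v : F => U (t • v)) ∘ σ₂)) u'‖ ≤
          (|t| ^ 3 * Λ₃) * ((N₂ : ℝ)⁻¹ - c₂)⁻¹ * (((N₂ : ℝ)⁻¹ - c₂)⁻¹) ^ 2 *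
            (1 + 2 * (t ^ 2 * H) * ((N₂ : ℝ)⁻¹ - c₂)⁻¹) * ‖u - u'‖) ∧
      fderiv ℝ ((fun v : F => U (t • v)) ∘ σ₂) (D₂ (t⁻¹ • w₀)) = 0 := by
  have ht' : 0 < |t| := abs_pos.mpr ht
  -- HSRL: every letter rescaled, on `ball (t⁻¹ • w₀) (ρ / |t|)`
  obtain ⟨-, h1, -, h3, h4, h5, h6, h7⟩ :=
    HardStepRescalingLetters.rescaled_letters (U := U) D ht hρ hσ hσ₂ hU hU₂ hU'' hU''₂ hcrit
  -- the closed ball of radius r₂ sits inside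
  have sub : closedBall (t⁻¹ • w₀) r₂ ⊆ ball (t⁻¹ • w₀) (ρ / |t|) := closedBall_subset_ball hr₂ρ
  have h0 : t⁻¹ • w₀ ∈ ball (t⁻¹ • w₀) (ρ / |t|) := mem_ball_self (div_pos hρ ht')
  -- on the ball, the second derivative IS the displayed Hessian
  have e2 : ∀ v ∈ ball (t⁻¹ • w₀) (ρ / |t|),
      fderiv ℝ (fderiv ℝ (fun v : F => U (t • v))) v = (t ^ 2) • U'' (t • v) := fun v hv => (h5 v hv).1.fderiv
  -- the centre's Hessian is `t² • U″ w₀`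
  have ec : (t ^ 2) • U'' (t • (t⁻¹ • w₀)) = (t ^ 2) • U'' w₀ := by rw [smul_inv_smul₀ ht]
  -- AHE's condition from the monotone form
  have hB0 : ‖(t ^ 2) • U'' (t • (t⁻¹ • w₀))‖ ≤ t ^ 2 * H := by
    rw [← e2 _ h0]; exact (h5 _ h0).2
  have hN₂' : (1 + ‖(fun v : F => (t ^ 2) • U'' (t • v)) (t⁻¹ • w₀)‖ / m₂) * ‖M₂‖ + m₂⁻¹ ≤ (N₂ : ℝ) := by
    refine le_trans ?_ hN₂
    have h1' : ‖(fun v : F => (t ^ 2) • U'' (t • v)) (t⁻¹ • w₀)‖ / m₂ ≤ t ^ 2 * H / m₂ :=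
      div_le_div_of_nonneg_right hB0 hm₂.le
    have h2' : 0 ≤ ‖M₂‖ := norm_nonneg _
    nlinarith
  have hco₂' : ∀ κ, D₂ κ = 0 → m₂ * ‖κ‖ ^ 2 ≤ (fun v : F => (t ^ 2) • U'' (t • v)) (t⁻¹ • w₀) κ κ := by
    intro κ hκ
    have := hco₂ κ hκ
    simpa only [ec] using this
  have hΛ' : 0 ≤ |t| ^ 3 * Λ₃ := mul_nonneg (pow_nonneg ht'.le 3) hΛ₃
  -- the scale-(k+1) letters in `inductiveStep`'s binder shapes
  have hVd₂ : ∀ x ∈ closedBall (t⁻¹ • w₀) r₂, DifferentiableAt ℝ (fun v : F => U (t • v)) x :=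
    fun x hx => (h3 x (sub hx)).1
  have hV₂ : ∀ x ∈ closedBall (t⁻¹ • w₀) r₂,
      HasFDerivAt (fderiv ℝ (fun v : F => U (t • v))) ((fun v : F => (t ^ 2) • U'' (t • v)) x) x :=
    fun x hx => (h5 x (sub hx)).1
  have hVc₂ : ∀ x ∈ closedBall (t⁻¹ • w₀) r₂,
      ‖(fun v : F => (t ^ 2) • U'' (t • v)) x - (fun v : F => (t ^ 2) • U'' (t • v)) (t⁻¹ • w₀)‖ ≤ (c₂ : ℝ) := by
    intro x hx
    show ‖(t ^ 2) • U'' (t • x) - (t ^ 2) • U'' (t • (t⁻¹ • w₀))‖ ≤ (c₂ : ℝ)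
    rw [← e2 x (sub hx), ← e2 _ h0]
    have hx' : ‖x - t⁻¹ • w₀‖ ≤ r₂ := by rwa [mem_closedBall, dist_eq_norm] at hx
    calc ‖fderiv ℝ (fderiv ℝ (fun v : F => U (t • v))) x - fderiv ℝ (fderiv ℝ (fun v : F => U (t • v))) (t⁻¹ • w₀)‖
        ≤ |t| ^ 3 * Λ₃ * ‖x - t⁻¹ • w₀‖ := h6 x (sub hx) _ h0
      _ ≤ |t| ^ 3 * Λ₃ * r₂ := mul_le_mul_of_nonneg_left hx' hΛ'
      _ ≤ c₂ := hc₂r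
  have hlip₂ : ∀ x ∈ closedBall (t⁻¹ • w₀) r₂, ∀ x' ∈ closedBall (t⁻¹ • w₀) r₂,
      ‖(fun v : F => (t ^ 2) • U'' (t • v)) x - (fun v : F => (t ^ 2) • U'' (t • v)) x'‖ ≤ |t| ^ 3 * Λ₃ * ‖x - x'‖ := by
    intro x hx x' hx'
    show ‖(t ^ 2) • U'' (t • x) - (t ^ 2) • U'' (t • x')‖ ≤ |t| ^ 3 * Λ₃ * ‖x - x'‖
    rw [← e2 x (sub hx), ← e2 x' (sub hx')]
    exact h6 x (sub hx) x' (sub hx')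
  have hVB₂ : ∀ x ∈ closedBall (t⁻¹ • w₀) r₂, ‖(fun v : F => (t ^ 2) • U'' (t • v)) x‖ ≤ t ^ 2 * H := by
    intro x hx
    show ‖(t ^ 2) • U'' (t • x)‖ ≤ t ^ 2 * H
    rw [← e2 x (sub hx)]
    exact (h5 x (sub hx)).2
  have hVG₂ : ∀ x ∈ closedBall (t⁻¹ • w₀) r₂, ‖fderiv ℝ (fun v : F => U (t • v)) x‖ ≤ |t| * G₁ :=
    fun x hx => (h3 x (sub hx)).2
  exact HardStepInductiveStep.inductiveStep (V := fun v : F => U (t • v)) (V'' := fun v : F => (t ^ 2) • U'' (t • v))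
    (δ₀ := t⁻¹ • w₀) D₂ M₂ hM₂ hm₂ hco₂' hN₂' hc₂ hr₂ hVd₂ hV₂ hVc₂ h7 hΛ' hlip₂ hVB₂ hVG₂

/-! ## §2. Two steps: `inductiveStep` ∘ `rescaled_letters` ∘ `inductiveStep` -/

/-- **TWO STEPS OF THE TOWER.**  `inductiveStep`'s scale-`k` hypotheses VERBATIM (blocking `D` with right inverse `M`, action `V` with
Hessian `V″` on `closedBall δ₀ r`, kernel coercivity `m`, FULL criticality, equivalence bound `N`, margin `c < N⁻¹`, sizes `M₃, B, G`),
a homothety `t ≠ 0`, and the scale-`(k+1)` data: blocking `D₂ : F →L F₂` with right inverse `M₂`, the next kernel coercivity `m₂` of the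
rescaled transported Hessian `t² • V″(δ₀)[S·, S·]` on `ker D₂` for EVERY section `S` of `D` with `‖S‖ ≤ K₁ := (N⁻¹ − c)⁻¹` (TFC's letter),
`N₂, c₂` with `c₂ < N₂⁻¹` and `(1 + t²BK₁²∕m₂)‖M₂‖ + m₂⁻¹ ≤ N₂`, a radius `0 < r₂ < (N⁻¹ − c)r∕|t|` with
`|t|³·M₃K₁K₁²(1 + 2BK₁)·r₂ ≤ c₂` ⟹ charts `σ₁ : F → E`, `σ₂ : F₂ → F` with `σ₁(Dδ₀) = δ₀`, `σ₂(D₂v₀) = v₀` (`v₀ := t⁻¹ • Dδ₀`), the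
scale-`(k+1)` chart letters of `σ₂` (range, differentiability, slice property for `D₂`, `‖σ₂′‖ ≤ (N₂⁻¹ − c₂)⁻¹`), the first-order letters of
the twice-renormalised action `((V ∘ σ₁) ∘ (t•)) ∘ σ₂` (`‖D·‖ ≤ |t|GK₁(N₂⁻¹ − c₂)⁻¹`), and its FULL criticality at `D₂v₀` — the induction
re-enters (the complete block is §1's, with `U := V ∘ σ₁`). [folklore] -/
theorem twoSteps (D : E →L[ℝ] F) (M : F →L[ℝ] E) (hM : ∀ w, D (M w) = w)
    {V : E → ℝ} {V'' : E → E →L[ℝ] E →L[ℝ] ℝ} {δ₀ : E} {m : ℝ} (hm : 0 < m)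
    (hco : ∀ κ, D κ = 0 → m * ‖κ‖ ^ 2 ≤ V'' δ₀ κ κ)
    {N c : ℝ≥0} (hN : (1 + ‖V'' δ₀‖ / m) * ‖M‖ + m⁻¹ ≤ (N : ℝ)) (hc : c < N⁻¹) {r : ℝ} (hr : 0 < r)
    (hVd : ∀ x ∈ closedBall δ₀ r, DifferentiableAt ℝ V x)
    (hV : ∀ x ∈ closedBall δ₀ r, HasFDerivAt (fderiv ℝ V) (V'' x) x)
    (hVc : ∀ x ∈ closedBall δ₀ r, ‖V'' x - V'' δ₀‖ ≤ c)
    (hcrit0 : fderiv ℝ V δ₀ = 0)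
    {M₃ B G : ℝ} (hM₃ : 0 ≤ M₃)
    (hV''lip : ∀ x ∈ closedBall δ₀ r, ∀ x' ∈ closedBall δ₀ r, ‖V'' x - V'' x'‖ ≤ M₃ * ‖x - x'‖)
    (hVB : ∀ x ∈ closedBall δ₀ r, ‖V'' x‖ ≤ B) (hVG : ∀ x ∈ closedBall δ₀ r, ‖fderiv ℝ V x‖ ≤ G)
    -- the rescaling
    {t : ℝ} (ht : t ≠ 0)
    -- scale k+1
    (D₂ : F →L[ℝ] F₂) (M₂ : F₂ →L[ℝ] F) (hM₂ : ∀ u, D₂ (M₂ u) = u) {m₂ : ℝ} (hm₂ : 0 < m₂)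
    (hco₂ : ∀ S : F →L[ℝ] E, (∀ k, D (S k) = k) → ‖S‖ ≤ ((N : ℝ)⁻¹ - c)⁻¹ →
      ∀ κ, D₂ κ = 0 → m₂ * ‖κ‖ ^ 2 ≤ ((t ^ 2) • (V'' δ₀).bilinearComp S S) κ κ)
    {N₂ c₂ : ℝ≥0}
    (hN₂ : (1 + t ^ 2 * (B * (((N : ℝ)⁻¹ - c)⁻¹) ^ 2) / m₂) * ‖M₂‖ + m₂⁻¹ ≤ (N₂ : ℝ)) (hc₂ : c₂ < N₂⁻¹)
    {r₂ : ℝ} (hr₂ : 0 < r₂) (hr₂ρ : r₂ < ((N : ℝ)⁻¹ - c) * r / |t|)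
    (hc₂r : |t| ^ 3 * (M₃ * ((N : ℝ)⁻¹ - c)⁻¹ * (((N : ℝ)⁻¹ - c)⁻¹) ^ 2 * (1 + 2 * B * ((N : ℝ)⁻¹ - c)⁻¹)) * r₂ ≤
      (c₂ : ℝ)) :
    ∃ σ₁ : F → E, ∃ σ₂ : F₂ → F, σ₁ (D δ₀) = δ₀ ∧ σ₂ (D₂ (t⁻¹ • D δ₀)) = t⁻¹ • D δ₀ ∧
      (∀ u ∈ ball (D₂ (t⁻¹ • D δ₀)) (((N₂ : ℝ)⁻¹ - c₂) * r₂), σ₂ u ∈ closedBall (t⁻¹ • D δ₀) r₂ ∧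
        DifferentiableAt ℝ σ₂ u ∧ (∀ k, D₂ (fderiv ℝ σ₂ u k) = k) ∧ ‖fderiv ℝ σ₂ u‖ ≤ ((N₂ : ℝ)⁻¹ - c₂)⁻¹) ∧
      (∀ u ∈ ball (D₂ (t⁻¹ • D δ₀)) (((N₂ : ℝ)⁻¹ - c₂) * r₂),
        DifferentiableAt ℝ ((fun v : F => (V ∘ σ₁) (t • v)) ∘ σ₂) u ∧
        ‖fderiv ℝ ((fun v : F => (V ∘ σ₁) (t • v)) ∘ σ₂) u‖ ≤
          |t| * (G * ((N : ℝ)⁻¹ - c)⁻¹) * ((N₂ : ℝ)⁻¹ - c₂)⁻¹) ∧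
      fderiv ℝ ((fun v : F => (V ∘ σ₁) (t • v)) ∘ σ₂) (D₂ (t⁻¹ • D δ₀)) = 0 := by
  -- step k
  obtain ⟨σ₁, hσ0, ha, ha', hb, hb', hcc, hcc', hd⟩ :=
    HardStepInductiveStep.inductiveStep D M hM hm hco hN hc hr hVd hV hVc hcrit0 hM₃ hV''lip hVB hVG
  have hP : 0 < (N : ℝ)⁻¹ - c := sub_pos.mpr (by exact_mod_cast hc)
  have hρ : 0 < ((N : ℝ)⁻¹ - c) * r := mul_pos hP hr
  have hK : 0 < ((N : ℝ)⁻¹ - c)⁻¹ := inv_pos.mpr hP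
  have hB : 0 ≤ B := (norm_nonneg (V'' δ₀)).trans (hVB δ₀ (mem_closedBall_self hr.le))
  have hΛ₃ : 0 ≤ M₃ * ((N : ℝ)⁻¹ - c)⁻¹ * (((N : ℝ)⁻¹ - c)⁻¹) ^ 2 * (1 + 2 * B * ((N : ℝ)⁻¹ - c)⁻¹) := by positivity
  -- the section at the centre and the transported Hessian there
  have hw0 : D δ₀ ∈ ball (D δ₀) (((N : ℝ)⁻¹ - c) * r) := mem_ball_self hρ
  have hco₂' : ∀ κ, D₂ κ = 0 → m₂ * ‖κ‖ ^ 2 ≤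
      ((t ^ 2) • (V'' (σ₁ (D δ₀))).bilinearComp (fderiv ℝ σ₁ (D δ₀)) (fderiv ℝ σ₁ (D δ₀))) κ κ := by
    rw [hσ0]
    exact hco₂ _ (ha _ hw0).2.2.1 (ha _ hw0).2.2.2
  -- step k+1 through §1
  obtain ⟨σ₂, h20, h2a, -, h2b, -, -, -, h2d⟩ :=
    nextStep_of_letters (U := V ∘ σ₁)
      (U'' := fun w => (V'' (σ₁ w)).bilinearComp (fderiv ℝ σ₁ w) (fderiv ℝ σ₁ w)) D ht hρ ha ha' hb hb' hcc hcc' hd hΛ₃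
      D₂ M₂ hM₂ hm₂ hco₂' hN₂ hc₂ hr₂ hr₂ρ hc₂r
  exact ⟨σ₁, σ₂, hσ0, h20, h2a, h2b, h2d⟩

/-! ## §3. The coercivity hypothesis discharged by TFC's two-scale letter -/

/-- **TWO STEPS FROM THE TWO-SCALE LETTER.**  As `twoSteps`, with §2's universal coercivity hypothesis REPLACED by the two letters
`…TransportedFormCoercivity.kerCoercive_bilinearComp_div` consumes: the two-scale kernel coercivity `∀ v, D₂(Dv) = 0 → m₂‖v‖² ≤ V″(δ₀) v v`
(`m₂ > 0`) and the blocking's size `‖Dv‖ ≤ d‖v‖` (`d > 0`); the next scale's coercivity constant is `t²·m₂∕d²`, with which AHE's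
condition `(1 + t²BK₁²∕(t²m₂∕d²))‖M₂‖ + (t²m₂∕d²)⁻¹ ≤ N₂` is read. [folklore] -/
theorem twoSteps_of_twoScale (D : E →L[ℝ] F) (M : F →L[ℝ] E) (hM : ∀ w, D (M w) = w)
    {V : E → ℝ} {V'' : E → E →L[ℝ] E →L[ℝ] ℝ} {δ₀ : E} {m : ℝ} (hm : 0 < m)
    (hco : ∀ κ, D κ = 0 → m * ‖κ‖ ^ 2 ≤ V'' δ₀ κ κ)
    {N c : ℝ≥0} (hN : (1 + ‖V'' δ₀‖ / m) * ‖M‖ + m⁻¹ ≤ (N : ℝ)) (hc : c < N⁻¹) {r : ℝ} (hr : 0 < r)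
    (hVd : ∀ x ∈ closedBall δ₀ r, DifferentiableAt ℝ V x)
    (hV : ∀ x ∈ closedBall δ₀ r, HasFDerivAt (fderiv ℝ V) (V'' x) x)
    (hVc : ∀ x ∈ closedBall δ₀ r, ‖V'' x - V'' δ₀‖ ≤ c)
    (hcrit0 : fderiv ℝ V δ₀ = 0)
    {M₃ B G : ℝ} (hM₃ : 0 ≤ M₃)
    (hV''lip : ∀ x ∈ closedBall δ₀ r, ∀ x' ∈ closedBall δ₀ r, ‖V'' x - V'' x'‖ ≤ M₃ * ‖x - x'‖)
    (hVB : ∀ x ∈ closedBall δ₀ r, ‖V'' x‖ ≤ B) (hVG : ∀ x ∈ closedBall δ₀ r, ‖fderiv ℝ V x‖ ≤ G)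
    {t : ℝ} (ht : t ≠ 0)
    (D₂ : F →L[ℝ] F₂) (M₂ : F₂ →L[ℝ] F) (hM₂ : ∀ u, D₂ (M₂ u) = u)
    -- TFC's two letters
    {m₂ : ℝ} (hm₂ : 0 < m₂) (hco₂ : ∀ v, D₂ (D v) = 0 → m₂ * ‖v‖ ^ 2 ≤ V'' δ₀ v v)
    {d : ℝ} (hd0 : 0 < d) (hd : ∀ v, ‖D v‖ ≤ d * ‖v‖)
    {N₂ c₂ : ℝ≥0}
    (hN₂ : (1 + t ^ 2 * (B * (((N : ℝ)⁻¹ - c)⁻¹) ^ 2) / (t ^ 2 * (m₂ / d ^ 2))) * ‖M₂‖ + (t ^ 2 * (m₂ / d ^ 2))⁻¹ ≤ (N₂ : ℝ))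
    (hc₂ : c₂ < N₂⁻¹)
    {r₂ : ℝ} (hr₂ : 0 < r₂) (hr₂ρ : r₂ < ((N : ℝ)⁻¹ - c) * r / |t|)
    (hc₂r : |t| ^ 3 * (M₃ * ((N : ℝ)⁻¹ - c)⁻¹ * (((N : ℝ)⁻¹ - c)⁻¹) ^ 2 * (1 + 2 * B * ((N : ℝ)⁻¹ - c)⁻¹)) * r₂ ≤
      (c₂ : ℝ)) :
    ∃ σ₁ : F → E, ∃ σ₂ : F₂ → F, σ₁ (D δ₀) = δ₀ ∧ σ₂ (D₂ (t⁻¹ • D δ₀)) = t⁻¹ • D δ₀ ∧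
      (∀ u ∈ ball (D₂ (t⁻¹ • D δ₀)) (((N₂ : ℝ)⁻¹ - c₂) * r₂), σ₂ u ∈ closedBall (t⁻¹ • D δ₀) r₂ ∧
        DifferentiableAt ℝ σ₂ u ∧ (∀ k, D₂ (fderiv ℝ σ₂ u k) = k) ∧ ‖fderiv ℝ σ₂ u‖ ≤ ((N₂ : ℝ)⁻¹ - c₂)⁻¹) ∧
      (∀ u ∈ ball (D₂ (t⁻¹ • D δ₀)) (((N₂ : ℝ)⁻¹ - c₂) * r₂),
        DifferentiableAt ℝ ((fun v : F => (V ∘ σ₁) (t • v)) ∘ σ₂) u ∧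
        ‖fderiv ℝ ((fun v : F => (V ∘ σ₁) (t • v)) ∘ σ₂) u‖ ≤
          |t| * (G * ((N : ℝ)⁻¹ - c)⁻¹) * ((N₂ : ℝ)⁻¹ - c₂)⁻¹) ∧
      fderiv ℝ ((fun v : F => (V ∘ σ₁) (t • v)) ∘ σ₂) (D₂ (t⁻¹ • D δ₀)) = 0 := by
  have ht2 : 0 < t ^ 2 := by positivity
  have hm₂' : 0 < t ^ 2 * (m₂ / d ^ 2) := mul_pos ht2 (div_pos hm₂ (by positivity))
  refine twoSteps D M hM hm hco hN hc hr hVd hV hVc hcrit0 hM₃ hV''lip hVB hVG ht D₂ M₂ hM₂ hm₂' ?_ hN₂ hc₂ hr₂ hr₂ρ hc₂r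
  intro S hS _ κ hκ
  have h := TransportedFormCoercivity.kerCoercive_bilinearComp_div (Q := V'' δ₀) hS D₂ hm₂.le hco₂ hd0 hd κ hκ
  rw [smul_apply, smul_apply, smul_eq_mul, mul_assoc]
  exact mul_le_mul_of_nonneg_left h ht2.le

end Summit.QuantumFields.BalabanUV.T4Continuum.NE7b.HardStepTowerTwoSteps

end
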